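import Literature.Computability.Cryptography.RegevLWESolveIdealised
import HarnessLib

/-!
# Regev 2009, Lemmas 3.7 / 4.1 / 3.6 combined, for a RANDOMISED oracle: the idealised secret-finding experiment with a kernel and its failure bound

Topic `Computability/Cryptography` (family `pqc`), grouping namespace `Regev2009`; the twin of
`RegevLWESolveIdealised.lean` (the experiment "shift, query, un-shift, verify; output the first accepted
candidate" and its failure bound `n_B·η_A + (1 - σ(1 - η_R))^{|T|}`, for a DETERMINISTIC oracle `F`)
for an oracle that is a Markov KERNEL `A : (m samples) → PMF(secret)` (`LWE.Solver`) — the form in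
which a randomised or quantum `LWE` solver enters Regev's Theorem 1.1 / 3.1 (pqc.S19,
`regev_lwe_to_sivp_quantum`: the oracle `W` is a uniform quantum circuit family, whose answer on a
batch of samples is a distribution, `UniformQCircuitFamily.searchLWESolver`; its guarantee
`SolvesSearchLWEWorstCase` is per secret, hence also on average). Regev's proof of Lemma 3.7 treats `W`
as such ("we apply `W` … if `s'` is accepted we output it; … with probability exponentially close to
1"): each call of the oracle is a fresh draw. Everything here is PROVED; the definitions have bodies;
no named fact.

The experiment, block by block (`blockLawK`): a uniform shift `t`, a batch of `m` coarse samples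
`A_{s,χO}^m`, the oracle's ANSWER `a ∼ A(shift_t batch)` drawn given the batch, and an independent
batch of `N_V` fine samples for the verification test; the candidate is `a - t` (`candidateK`), a
block accepts when its verification batch lies in the acceptance event of its candidate
(`AcceptsK`), the output is the first accepted candidate (`firstAcceptedK`). The failure bound
(`toReal_firstAcceptedK_ne_le`) is the one of the deterministic file with
`σ ≤ searchSuccessProb (χO j) m A` — the kernel's AVERAGE-case success probability, which is what
the tree's `LWE.searchSuccessProb` measures for a kernel already (the deterministic file instantiates
it at `pure ∘ F`).

## Results

* `firstAcceptedK_ne_some` — a wrong output forces a false acceptance somewhere or no good block;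
* `toOuterMeasure_badAcceptK_le` — per block, `Pr[accept ∧ candidate ≠ s] ≤ η_A`;
* `toOuterMeasure_candidateK_eq_searchSuccessProb` — per block, **`Pr[candidate = s] = searchSuccessProb χ m A`**
  (Regev's shift: the shifted batch is `A_{s+t,χ}^m`, `lweSamples_map_shift`, `s + t` uniform);
* `toOuterMeasure_goodK_eq` — per block, `Pr[accept ∧ candidate = s] = Pr[candidate = s]·Pr[test accepts s]`;
* **`toReal_firstAcceptedK_ne_le`** — `Pr[output ≠ s] ≤ n_B·η_A + (1 - σ(1 - η_R))^{|T|}`.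

## References

* O. Regev, *On lattices, learning with errors, random linear codes, and cryptography*, J. ACM 56
  (2009), art. 34 = arXiv:2401.03703: Lemma 3.6, Lemma 3.7 (proof), Lemma 4.1 (proof), §4 (a solver
  is an arbitrary, possibly quantum, procedure) [RegevLWE2009].
* C. Peikert, *Public-key cryptosystems from the worst-case shortest vector problem*, STOC 2009,
  Prop. 3.2 [Peikert2009].
-/

noncomputable section

open Finset
open scoped ENNReal

namespace Literature.Computability.Cryptography

namespace Regev2009

open Literature.Probability.Distributions Literature.Probability.Moments LWE

section Blocks

variable {ι : Type} [Fintype ι] [DecidableEq ι] (q K : ℕ) [NeZero q] (m NV : ℕ)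

/-- LOCAL GLUE. **The law of the oracle part of one block**: a uniform shift `t`, a batch of `m`
coarse samples `A_{s,χO}^m`, and the oracle's answer drawn from the kernel on the SHIFTED batch.
[cite: RegevLWE2009, Lemma 3.7 (proof) with Lemma 4.1 (proof)] -/
def queryLawK (χO : PMF (ZMod q)) (A : Solver ι (ZMod q) m) (s : ι → ZMod q) :
    PMF (((ι → ZMod q) × (Fin m → (ι → ZMod q) × ZMod q)) × (ι → ZMod q)) :=
  (prodLaw (PMF.uniformOfFintype (ι → ZMod q)) (lweSamples χO s m)).bind fun w =>
    (A (shiftSample w.1 ∘ w.2)).map fun a => (w, a)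

/-- LOCAL GLUE. **The ideal law of one block of the experiment with a kernel oracle**: the oracle part
and, independently, a batch of `N_V` fine samples `A^{(K)}_{s,χV}` for the verification test.
[cite: RegevLWE2009, Lemma 3.7 (proof) with Lemma 4.1 (proof) and Lemma 3.6] -/
def blockLawK (χO : PMF (ZMod q)) (χV : PMF (ZMod (q * K))) (A : Solver ι (ZMod q) m) (s : ι → ZMod q) :
    PMF ((((ι → ZMod q) × (Fin m → (ι → ZMod q) × ZMod q)) × (ι → ZMod q)) ×
      (Fin NV → (ι → ZMod q) × ZMod (q * K))) :=
  prodLaw (queryLawK q m χO A s) (iidPMF (lweSampleK q K χV s) NV)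

/-- LOCAL GLUE. **The candidate of a block**: the oracle's answer un-shifted. [cite: RegevLWE2009, Lemma 4.1 (proof)] -/
def candidateK (w : ((ι → ZMod q) × (Fin m → (ι → ZMod q) × ZMod q)) × (ι → ZMod q)) : ι → ZMod q :=
  w.2 - w.1.1

/-- LOCAL GLUE. A block ACCEPTS when its verification batch lies in the acceptance event `Acc c` of the
verification test for its own candidate `c`. [cite: RegevLWE2009, Lemma 3.7 (proof: "we then use Lemma 3.6 to verify") with Lemma 3.6] -/
def AcceptsK (Acc : (ι → ZMod q) → Set (Fin NV → (ι → ZMod q) × ZMod (q * K)))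
    (d : (((ι → ZMod q) × (Fin m → (ι → ZMod q) × ZMod q)) × (ι → ZMod q)) ×
      (Fin NV → (ι → ZMod q) × ZMod (q * K))) : Prop :=
  d.2 ∈ Acc (candidateK q m d.1)

open scoped Classical in
/-- LOCAL GLUE. **The output**: the candidate of the first accepting block along the block order, or
`none`. [cite: RegevLWE2009, Lemma 3.7 (proof)] -/
def firstAcceptedK (Acc : (ι → ZMod q) → Set (Fin NV → (ι → ZMod q) × ZMod (q * K))) {nB : ℕ}
    (D : Fin nB → (((ι → ZMod q) × (Fin m → (ι → ZMod q) × ZMod q)) × (ι → ZMod q)) ×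
      (Fin NV → (ι → ZMod q) × ZMod (q * K))) : Option (ι → ZMod q) :=
  if h : ∃ j, AcceptsK q K m NV Acc (D j) then some (candidateK q m (D (Fin.find _ h)).1) else none

variable {q K m NV}

omit [Fintype ι] [DecidableEq ι] [NeZero q] in
/-- **The case analysis.** If the output is not `some s` then either some block accepted a WRONG
candidate, or no block at all accepted the right one. [folklore] -/
theorem firstAcceptedK_ne_some
    {Acc : (ι → ZMod q) → Set (Fin NV → (ι → ZMod q) × ZMod (q * K))} {nB : ℕ}
    {D : Fin nB → (((ι → ZMod q) × (Fin m → (ι → ZMod q) × ZMod q)) × (ι → ZMod q)) ×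
      (Fin NV → (ι → ZMod q) × ZMod (q * K))} {s : ι → ZMod q}
    (h : firstAcceptedK q K m NV Acc D ≠ some s) :
    (∃ j, AcceptsK q K m NV Acc (D j) ∧ candidateK q m (D j).1 ≠ s) ∨
      ∀ j, ¬(AcceptsK q K m NV Acc (D j) ∧ candidateK q m (D j).1 = s) := by
  classical
  unfold firstAcceptedK at h
  by_cases hex : ∃ j, AcceptsK q K m NV Acc (D j)
  · rw [dif_pos hex] at h
    exact Or.inl ⟨Fin.find _ hex, Fin.find_spec hex, fun hc => h (by rw [hc])⟩
  · exact Or.inr fun j hj => hex ⟨j, hj.1⟩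

variable (q K m NV)

/-! ### One block -/

/-- **False acceptance, per block.** If the test accepts every wrong candidate with probability
`≤ η_A`, then a block accepts a wrong candidate with probability `≤ η_A` — its verification batch is
independent of its candidate. [cite: RegevLWE2009, Lemma 3.6 with Lemma 3.7 (proof)] -/
theorem toOuterMeasure_badAcceptK_le (χO : PMF (ZMod q)) (χV : PMF (ZMod (q * K))) (A : Solver ι (ZMod q) m)
    (s : ι → ZMod q) (Acc : (ι → ZMod q) → Set (Fin NV → (ι → ZMod q) × ZMod (q * K))) {ηA : ℝ≥0∞}
    (hA : ∀ c, c ≠ s → (iidPMF (lweSampleK q K χV s) NV).toOuterMeasure (Acc c) ≤ ηA) :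
    (blockLawK q K m NV χO χV A s).toOuterMeasure
        {d | AcceptsK q K m NV Acc d ∧ candidateK q m d.1 ≠ s} ≤ ηA := by
  refine toOuterMeasure_prodLaw_le _ _ _ fun w => ?_
  by_cases hc : candidateK q m w = s
  · have h0 : Prod.mk w ⁻¹' {d : ((((ι → ZMod q) × (Fin m → (ι → ZMod q) × ZMod q)) × (ι → ZMod q)) ×
        (Fin NV → (ι → ZMod q) × ZMod (q * K))) | AcceptsK q K m NV Acc d ∧ candidateK q m d.1 ≠ s} = ∅ := by
      ext V
      simp [hc]
    rw [h0, MeasureTheory.measure_empty]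
    exact bot_le
  · have h1 : Prod.mk w ⁻¹' {d : ((((ι → ZMod q) × (Fin m → (ι → ZMod q) × ZMod q)) × (ι → ZMod q)) ×
        (Fin NV → (ι → ZMod q) × ZMod (q * K))) | AcceptsK q K m NV Acc d ∧ candidateK q m d.1 ≠ s} =
        Acc (candidateK q m w) := by
      ext V
      simp [AcceptsK, hc]
    rw [h1]
    exact hA _ hc

/-- **Regev's shift, per block: `Pr[candidate = s]` is the AVERAGE-case success probability of the
kernel.** With `t` uniform and the batch `A_{s,χ}^m`, the shifted batch is `A_{s+t,χ}^m`
(`lweSamples_map_shift`) with `s + t` uniform, so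
`Pr_{t,batch,a}[a - t = s] = q⁻ⁿ ∑_{s'} Pr_{B ∼ A_{s',χ}^m, a ∼ A(B)}[a = s'] = searchSuccessProb χ m A`.
[cite: RegevLWE2009, Lemma 4.1 (proof)] -/
theorem toOuterMeasure_candidateK_eq_searchSuccessProb (χ : PMF (ZMod q)) (A : Solver ι (ZMod q) m)
    (s : ι → ZMod q) :
    (queryLawK q m χ A s).toOuterMeasure {w | candidateK q m w = s} = searchSuccessProb χ m A := by
  classical
  -- the mass of `{a - t = s}` given `(t, B)` is `A(shift_t B)(s + t)`
  have hsec : ∀ w : (ι → ZMod q) × (Fin m → (ι → ZMod q) × ZMod q),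
      ((A (shiftSample w.1 ∘ w.2)).map fun a => (w, a)).toOuterMeasure {w' | candidateK q m w' = s} =
        A (shiftSample w.1 ∘ w.2) (s + w.1) := by
    intro w
    rw [PMF.toOuterMeasure_map_apply, ← PMF.toOuterMeasure_apply_singleton]
    congr 1
    ext a
    simp only [Set.mem_preimage, Set.mem_setOf_eq, candidateK, Set.mem_singleton_iff]
    exact sub_eq_iff_eq_add
  rw [queryLawK, PMF.toOuterMeasure_bind_apply]
  simp_rw [hsec]
  -- split the sum over `(t, B)`
  rw [ENNReal.tsum_prod', tsum_fintype, searchSuccessProb]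
  -- reindex the average over the secret by `s' = s + t`
  rw [← Fintype.sum_equiv (Equiv.addLeft s)
    (fun t => PMF.uniformOfFintype (ι → ZMod q) (s + t) * searchSuccessProbOf χ m A (s + t))
    (fun s' => PMF.uniformOfFintype (ι → ZMod q) s' * searchSuccessProbOf χ m A s') (fun t => rfl)]
  refine Finset.sum_congr rfl fun t _ => ?_
  simp_rw [prodLaw_apply', mul_assoc]
  rw [ENNReal.tsum_mul_left]
  simp only [PMF.uniformOfFintype_apply]
  congr 1
  rw [searchSuccessProbOf, ← lweSamples_map_shift χ s t m, PMF.bind_map, PMF.bind_apply]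
  rfl

/-- **A good block, per block**: `Pr[accept ∧ candidate = s] = Pr[candidate = s] · Pr[test accepts s]`.
[cite: RegevLWE2009, Lemma 3.7 (proof) with Lemma 3.6] -/
theorem toOuterMeasure_goodK_eq (χO : PMF (ZMod q)) (χV : PMF (ZMod (q * K))) (A : Solver ι (ZMod q) m)
    (s : ι → ZMod q) (Acc : (ι → ZMod q) → Set (Fin NV → (ι → ZMod q) × ZMod (q * K))) :
    (blockLawK q K m NV χO χV A s).toOuterMeasure {d | AcceptsK q K m NV Acc d ∧ candidateK q m d.1 = s} =
      searchSuccessProb χO m A * (iidPMF (lweSampleK q K χV s) NV).toOuterMeasure (Acc s) := by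
  have hset : {d : ((((ι → ZMod q) × (Fin m → (ι → ZMod q) × ZMod q)) × (ι → ZMod q)) ×
      (Fin NV → (ι → ZMod q) × ZMod (q * K))) | AcceptsK q K m NV Acc d ∧ candidateK q m d.1 = s} =
      {w | candidateK q m w = s} ×ˢ Acc s := by
    ext ⟨w, V⟩
    simp only [Set.mem_setOf_eq, Set.mem_prod, AcceptsK]
    constructor
    · rintro ⟨hA, hc⟩
      exact ⟨hc, hc ▸ hA⟩
    · rintro ⟨hc, hA⟩
      exact ⟨hc.symm ▸ hA, hc⟩
  rw [blockLawK, hset, toOuterMeasure_prodLaw_prod, toOuterMeasure_candidateK_eq_searchSuccessProb]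

/-! ### All blocks: the failure bound -/

/-- **Regev 2009, Lemmas 3.7 + 4.1 + 3.6 with a kernel oracle — the failure bound of the idealised
experiment.** Blocks `j < n_B` independent with laws `blockLawK (χO j) χV A s`; the test accepts each
wrong candidate with probability `≤ η_A` and rejects `s` with probability `≤ η_R ≤ 1`; on the blocks
of `T` the kernel's average-case success probability is `≥ σ`. Then
`Pr[firstAcceptedK ≠ some s] ≤ n_B·η_A + (1 - σ(1 - η_R))^{|T|}`.
[cite: RegevLWE2009, Lemma 3.7 (proof) with Lemma 4.1 (proof) and Lemma 3.6] -/
theorem toReal_firstAcceptedK_ne_le {nB : ℕ} (χO : Fin nB → PMF (ZMod q)) (χV : PMF (ZMod (q * K)))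
    (A : Solver ι (ZMod q) m) (s : ι → ZMod q)
    (Acc : (ι → ZMod q) → Set (Fin NV → (ι → ZMod q) × ZMod (q * K))) {ηA ηR σ : ℝ}
    (hηA : 0 ≤ ηA)
    (hA : ∀ c, c ≠ s → ((iidPMF (lweSampleK q K χV s) NV).toOuterMeasure (Acc c)).toReal ≤ ηA)
    (hR : ((iidPMF (lweSampleK q K χV s) NV).toOuterMeasure (Acc s)ᶜ).toReal ≤ ηR)
    (hηR : ηR ≤ 1) (T : Finset (Fin nB))
    (hσ : ∀ j ∈ T, σ ≤ (searchSuccessProb (χO j) m A).toReal) :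
    ((indepLaw nB fun j => blockLawK q K m NV (χO j) χV A s).toOuterMeasure
        {D | firstAcceptedK q K m NV Acc D ≠ some s}).toReal ≤
      nB * ηA + (1 - σ * (1 - ηR)) ^ T.card := by
  classical
  -- abbreviations
  set P := indepLaw nB fun j => blockLawK q K m NV (χO j) χV A s with hP
  set Bad : Set ((((ι → ZMod q) × (Fin m → (ι → ZMod q) × ZMod q)) × (ι → ZMod q)) ×
      (Fin NV → (ι → ZMod q) × ZMod (q * K))) :=
    {d | AcceptsK q K m NV Acc d ∧ candidateK q m d.1 ≠ s} with hBad
  set Good : Set ((((ι → ZMod q) × (Fin m → (ι → ZMod q) × ZMod q)) × (ι → ZMod q)) ×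
      (Fin NV → (ι → ZMod q) × ZMod (q * K))) :=
    {d | AcceptsK q K m NV Acc d ∧ candidateK q m d.1 = s} with hGood
  set VB := iidPMF (lweSampleK q K χV s) NV with hVB
  -- the two events
  set E1 : Set (Fin nB → _) := ⋃ j, {D | D j ∈ Bad} with hE1
  set E2 : Set (Fin nB → _) := {D | ∀ j, D j ∈ (if j ∈ T then Goodᶜ else Set.univ)} with hE2
  have hsub : {D | firstAcceptedK q K m NV Acc D ≠ some s} ⊆ E1 ∪ E2 := by
    intro D hD
    rcases firstAcceptedK_ne_some hD with ⟨j, hj⟩ | hall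
    · exact Or.inl (Set.mem_iUnion.2 ⟨j, hj⟩)
    · refine Or.inr fun j => ?_
      split_ifs
      · exact hall j
      · exact Set.mem_univ _
  -- `Pr[E1] ≤ n_B η_A`
  have hA' : ∀ c, c ≠ s → VB.toOuterMeasure (Acc c) ≤ ENNReal.ofReal ηA := fun c hc => by
    rw [← ENNReal.ofReal_toReal (pmf_toOuterMeasure_ne_top VB _)]
    exact ENNReal.ofReal_le_ofReal (hA c hc)
  have h1 : (P.toOuterMeasure E1).toReal ≤ nB * ηA := by
    have hle : P.toOuterMeasure E1 ≤ ∑ j : Fin nB, ENNReal.ofReal ηA := by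
      refine (MeasureTheory.measure_iUnion_fintype_le _ _).trans (sum_le_sum fun j _ => ?_)
      rw [hP, indepLaw_toOuterMeasure_apply_preimage]
      exact toOuterMeasure_badAcceptK_le q K m NV (χO j) χV A s Acc hA'
    have := ENNReal.toReal_mono (ENNReal.sum_ne_top.2 fun j _ => ENNReal.ofReal_ne_top) hle
    refine this.trans (le_of_eq ?_)
    rw [ENNReal.toReal_sum fun j _ => ENNReal.ofReal_ne_top, sum_const, card_univ, Fintype.card_fin,
      nsmul_eq_mul, ENNReal.toReal_ofReal hηA]
  -- `Pr[E2] ≤ (1 - σ(1 - η_R))^{|T|}`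
  have hacc : 1 - ηR ≤ (VB.toOuterMeasure (Acc s)).toReal := by
    have := toReal_toOuterMeasure_compl' VB (Acc s)
    linarith
  have hgood : ∀ j ∈ T, σ * (1 - ηR) ≤ ((blockLawK q K m NV (χO j) χV A s).toOuterMeasure Good).toReal :=
    fun j hj => by
      rw [hGood, toOuterMeasure_goodK_eq, ENNReal.toReal_mul]
      exact mul_le_mul (hσ j hj) hacc (by linarith) ENNReal.toReal_nonneg
  have h2 : (P.toOuterMeasure E2).toReal ≤ (1 - σ * (1 - ηR)) ^ T.card := by
    rw [hE2, hP, toOuterMeasure_indepLaw_pi, ENNReal.toReal_prod]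
    have hsplit : ∏ j, ((blockLawK q K m NV (χO j) χV A s).toOuterMeasure
        (if j ∈ T then Goodᶜ else Set.univ)).toReal =
        ∏ j ∈ T, ((blockLawK q K m NV (χO j) χV A s).toOuterMeasure Goodᶜ).toReal := by
      rw [← prod_filter_mul_prod_filter_not univ (· ∈ T)]
      have hT : univ.filter (· ∈ T) = T := by ext j; simp
      have h1' : ∏ j ∈ univ.filter (fun j => ¬j ∈ T), ((blockLawK q K m NV (χO j) χV A s).toOuterMeasure
          (if j ∈ T then Goodᶜ else Set.univ)).toReal = 1 :=
        prod_eq_one fun j hj => by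
          rw [mem_filter] at hj
          rw [if_neg hj.2, (PMF.toOuterMeasure_apply_eq_one_iff _ _).2 (Set.subset_univ _), ENNReal.toReal_one]
      rw [h1', mul_one, hT]
      exact prod_congr rfl fun j hj => by rw [if_pos hj]
    rw [hsplit]
    calc ∏ j ∈ T, ((blockLawK q K m NV (χO j) χV A s).toOuterMeasure Goodᶜ).toReal
        ≤ ∏ _j ∈ T, (1 - σ * (1 - ηR)) :=
          prod_le_prod (fun j _ => ENNReal.toReal_nonneg) fun j hj => by
            rw [toReal_toOuterMeasure_compl']
            linarith [hgood j hj]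
      _ = (1 - σ * (1 - ηR)) ^ T.card := prod_const _
  -- union bound
  calc (P.toOuterMeasure {D | firstAcceptedK q K m NV Acc D ≠ some s}).toReal
      ≤ (P.toOuterMeasure (E1 ∪ E2)).toReal :=
        ENNReal.toReal_mono (pmf_toOuterMeasure_ne_top _ _) (P.toOuterMeasure.mono hsub)
    _ ≤ (P.toOuterMeasure E1 + P.toOuterMeasure E2).toReal :=
        ENNReal.toReal_mono (ENNReal.add_ne_top.2 ⟨pmf_toOuterMeasure_ne_top _ _, pmf_toOuterMeasure_ne_top _ _⟩)
          (MeasureTheory.measure_union_le _ _)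
    _ = (P.toOuterMeasure E1).toReal + (P.toOuterMeasure E2).toReal :=
        ENNReal.toReal_add (pmf_toOuterMeasure_ne_top _ _) (pmf_toOuterMeasure_ne_top _ _)
    _ ≤ nB * ηA + (1 - σ * (1 - ηR)) ^ T.card := add_le_add h1 h2

/-! ### The deterministic experiment is the kernel experiment at a Dirac kernel -/

omit [DecidableEq ι] [NeZero q] in
/-- The candidate of the kernel experiment at the answer `F(shift_t B)` is the deterministic candidate.
[folklore] -/
theorem candidateK_mk (F : (Fin m → (ι → ZMod q) × ZMod q) → ι → ZMod q)
    (w : (ι → ZMod q) × (Fin m → (ι → ZMod q) × ZMod q)) :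
    candidateK q m (w, F (shiftSample w.1 ∘ w.2)) = candidate q m F w := rfl

/-- At the Dirac kernel `pure ∘ F` the oracle part of the block is the image of `(t, B)`. [folklore] -/
theorem queryLawK_pure (χO : PMF (ZMod q)) (F : (Fin m → (ι → ZMod q) × ZMod q) → ι → ZMod q) (s : ι → ZMod q) :
    queryLawK q m χO (fun B => PMF.pure (F B)) s =
      (prodLaw (PMF.uniformOfFintype (ι → ZMod q)) (lweSamples χO s m)).map
        fun w => (w, F (shiftSample w.1 ∘ w.2)) := by
  unfold queryLawK
  simp only [PMF.pure_map]
  exact PMF.bind_pure_comp _ _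

/-- **At the Dirac kernel `pure ∘ F` the kernel block law is the image of the deterministic block law**
(the answer component is the function `F(shift_t B)` of the rest). [folklore] -/
theorem blockLawK_pure (χO : PMF (ZMod q)) (χV : PMF (ZMod (q * K)))
    (F : (Fin m → (ι → ZMod q) × ZMod q) → ι → ZMod q) (s : ι → ZMod q) :
    blockLawK q K m NV χO χV (fun B => PMF.pure (F B)) s =
      (blockLaw q K m NV χO χV s).map (Prod.map (fun w => (w, F (shiftSample w.1 ∘ w.2))) id) := by
  rw [blockLaw, prodLaw_map_prodMap, PMF.map_id, blockLawK, queryLawK_pure]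

end Blocks

end Regev2009

end Literature.Computability.Cryptography

end
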